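import Literature.NumberTheory.NumberFields.CompletionLocalDegree
import Literature.IUT.LogVolume.FakeAdeleIndex
import HarnessLib

/-!
# The local degree `n_v := e_v · f_v` of `FakeAdeleIndex` is the degree `[F_v : ℚ_{p_v}]`

Dupuy–Hilado, *The statement of Mochizuki's Corollary 3.12*, §3.6 (read on the page in
`Literature.IUT.LogVolume.FakeAdeleIndex`): the probability weight of a place `v ∣ p` of `F₀` is
"`Pr(v) = [F_{0,v}:ℚ_p]/[F₀:ℚ]`", the degree of the COMPLETION. `FakeAdeleIndex` DEFINES the
weight through the local degree `localDegree F v := e_v · f_v` and records, as its one modelling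
note, that `e_v f_v = [F_v : ℚ_p]` "by the standard structure theorem for completions of number
fields (Neukirch II (8.2)/(8.5))", with `TODO(general form): n_v = finrank ℚ_[p]
(v.adicCompletion F)`. This proof-only companion DISCHARGES that note from the tree's local
degree theorem `Literature.NumberTheory.NumberFields.finrank_padic_adicCompletion_eq'`:

* `natCast_residueChar_mem` — `p_v ∈ 𝔭_v`;
* `localDegree_eq_finrank_of_continuous` — for ANY `ℚ_{p_v}`-algebra structure on `F_v` with
  continuous structure map, `localDegree F v = finrank ℚ_[p_v] (v.adicCompletion F)`;
* `localDegree_eq_finrank` — the same for the tree's canonical structure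
  `LocalField.adicCompletionPadicAlgebra` (THE unique continuous `ℚ_{p_v} → F_v`).

Number fields in `Type` (the universe convention of the tree's `SemiLocal`, see
`CompletionLocalDegree`). Theorems only; no definition, instance or named fact; nothing here
concerns the disputed parts of the IUT corpus.

[cite: DupuyHilado2025, §3.6] [cite: NeukirchANT1999, Ch. II Prop. (8.5)]
-/

noncomputable section

namespace Literature.IUT.LogVolume

open NumberField IsDedekindDomain
open Literature.NumberTheory.GaloisRepresentations.LocalField Literature.NumberTheory.NumberFields

variable (F : Type) [Field F] [NumberField F] (v : HeightOneSpectrum (𝓞 F))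

omit [NumberField F] in
/-- `p_v ∈ 𝔭_v`: the residue characteristic of `v` lies in the prime of `v`
(`FakeAdeleIndex.liesOver_residueChar`). [cite: DupuyHilado2025, §2.5.4] -/
theorem natCast_residueChar_mem : ((residueChar F v : ℕ) : 𝓞 F) ∈ v.asIdeal := by
  have h := (liesOver_residueChar F v).over
  have hmem : (residueChar F v : ℤ) ∈ v.asIdeal.under ℤ := by
    rw [← h]; exact Ideal.mem_span_singleton_self _
  rw [Ideal.under_def, Ideal.mem_comap] at hmem
  simpa using hmem

/-- **`n_v = [F_v : ℚ_{p_v}]`** for ANY `ℚ_{p_v}`-algebra structure on the completion `F_v` whose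
structure map is continuous (there is exactly one): the local degree `localDegree F v = e_v · f_v`
of `FakeAdeleIndex` (the weight numerator "`[F_{0,v}:ℚ_p]`" of Dupuy–Hilado §3.6) is the degree
of `F_v` over `ℚ_{p_v}`. [cite: DupuyHilado2025, §3.6] [cite: NeukirchANT1999, Ch. II Prop. (8.5)] -/
theorem localDegree_eq_finrank_of_continuous [Fact (residueChar F v).Prime]
    [Algebra ℚ_[residueChar F v] (v.adicCompletion F)]
    (hc : Continuous (algebraMap ℚ_[residueChar F v] (v.adicCompletion F))) :
    localDegree F v = Module.finrank ℚ_[residueChar F v] (v.adicCompletion F) := by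
  rw [finrank_padic_adicCompletion_eq' (residueChar F v) v (natCast_residueChar_mem F v) hc]
  rfl

/-- **`n_v = [F_v : ℚ_{p_v}]`** for the canonical `ℚ_{p_v}`-structure of `F_v`
(`LocalField.adicCompletionPadicAlgebra`, the unique continuous `ℚ_{p_v} → F_v`): the modelling
note / `TODO(general form)` of `FakeAdeleIndex`, discharged (for `F : Type`).
[cite: DupuyHilado2025, §3.6] [cite: NeukirchANT1999, Ch. II Prop. (8.5)] -/
theorem localDegree_eq_finrank :
    haveI : Fact (residueChar F v).Prime := ⟨residueChar_prime F v⟩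
    letI := adicCompletionPadicAlgebra v (residueChar F v) (natCast_residueChar_mem F v)
    localDegree F v = Module.finrank ℚ_[residueChar F v] (v.adicCompletion F) := by
  haveI : Fact (residueChar F v).Prime := ⟨residueChar_prime F v⟩
  letI := adicCompletionPadicAlgebra v (residueChar F v) (natCast_residueChar_mem F v)
  exact localDegree_eq_finrank_of_continuous F v
    (continuous_algebraMap_adicCompletionPadicAlgebra v _ (natCast_residueChar_mem F v))

end Literature.IUT.LogVolume

end
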